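import Mathlib.Analysis.SpecialFunctions.Log.Basic
import Mathlib.Analysis.SpecialFunctions.Pow.Real
import Mathlib.Analysis.Calculus.Deriv.Shift
import Mathlib.Dynamics.Ergodic.MeasurePreserving
import Mathlib.MeasureTheory.Integral.Bochner.Basic
import Literature.MathematicalPhysics.KineticTheory.FouriersLaw
import Literature.Probability.LatticeModels.GibbsSpecification
import HarnessLib

/-!
# Infinite-volume Hamiltonian dynamics of the oscillator chain on `ℤ`

Topic `Literature/MathematicalPhysics/KineticTheory`; definition request
`defn-InfiniteChainDynamics` (for `stmt-AtomisticToContinuum-0703`, Green–Kubo for the infinite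
pinned anharmonic chain, route `FourierGreenKubo` crux (iii)).

## The model (Lanford–Lebowitz–Lieb 1977, §2 eqs. (1a)–(1c), `ν = 1`, nearest neighbours)

For the chain data `P : OscillatorChain` (pinning `U`, coupling `V`; the bath constant `γ` is not
used here) a configuration is `σ = (q_i, p_i)_{i ∈ ℤ} : ℤ → ℝ × ℝ` and the equations of motion are
`dq_i/dt = p_i`, `dp_i/dt = F_i(q) = -U'(q_i) + R_i(q)`,
`R_i(q) = V'(q_{i+1} - q_i) - V'(q_i - q_{i-1})` (LLL (1a)–(1c) with `U_i = U`,
`V_j(q) = V(q_{j+1} - q_j)`, range `D = 1`).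

## Contents

* `ChainConfig`, `OscillatorChain.interactionForce/force/siteEnergy` (LLL's Lyapunov functions
  `ℒ_i = ½ p_i² + U(q_i) + K`, (2b)), `IsSolution`, `IsSolutionOn`, `IsSeveredSolution` (LLL
  (9a)–(9c): particles outside `Λ` tied down), the class `expTempered P r` of initial data with
  `ℒ(0) ∈ B_r`, i.e. `sup_j e^{-r|j|} ℒ_j < ∞` (LLL (4)).
* `InfiniteChainDynamics P`: a flow on an invariant set of configurations solving the equations,
  unique within that set; API `flow_add` (group law from uniqueness, proved).
* Gibbs states: `chainPotential`, `chainSupp`, `chainSpecification P T` (the finite-volume Gibbs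
  distributions `Z⁻¹ e^{-H_Λ/T} ∏_{j∈Λ} dq_j dp_j` with the configuration frozen outside `Λ`, LLL
  (14), built with `Literature.Probability.LatticeModels.gibbsSpecOfPotential`), `IsChainGibbsMeasure P T μ` (DLR).
* Green–Kubo objects for the requesting statement: `bondCurrentZ` (`j_x = -½(p_x + p_{x+1})
  V'(q_{x+1} - q_x)`, as `OscillatorChain.bondCurrent`), `InfiniteChainDynamics.PreservesMeasure`,
  `currentCorrelation D μ t = ∑_x ∫ j_0 · (j_x ∘ φ_t) dμ`, `HasAbsConvergentCorrelation`,
  `greenKuboConductivity D μ T = T⁻² ∫_0^∞ C(t) dt` (BLR 2000, eq. (37), infinite-volume form),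
  `HasGreenKubo` (summable ∧ integrable ∧ `0 < κ_GK`; request `defn-greenKuboConductivity`).
* Named facts (statements only, `Prop`s): `LanfordLebowitzLieb1977_thm1_chain` (strong existence
  under A2–A4 for `ℒ(0) ∈ B_r`), `LanfordLebowitzLieb1977_thm3_chain` (existence for `μ`-a.e.
  initial point, `μ` any Gibbs state, under A2, B1, B2).

## What is NOT vendored, and why (read before using)

* **Scope of the strong theorem.** LLL's condition A4 (`|p_i R_i(q)| ≤ ∑_j A_ij ℒ_j`) holds when
  `U` is a polynomial of degree `2n` and `R_i` a multinomial of degree `≤ n` (LLL §2 Example),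
  i.e. `deg V ≤ n + 1`. The requesting statement's chain `U = ω₂q²/2 + lam q⁴/4`,
  `V = r²/2 + β r⁴/4` (`β > 0`) has `n = 2`, `deg V' = 3 > 2`: A4 FAILS (`p q³` is not bounded by
  `p² + q⁴`), so Theorem 1 does not apply to it; the same restriction ("pinning dominates the
  interaction", (D1)–(D3)) is made in Pozzoli–Raquépas 2026 (arXiv:2603.17338, Lemma 2.18,
  Example 2.5). Only the weak Theorem 3 (a.e. existence w.r.t. a Gibbs state) covers that chain.
* **Uniqueness** (LLL Thm 2 / Thm 4) is not vendored: hypothesis (12a) is illegible in the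
  available scan and the printed growth condition (13), `|∂F_i/∂q_j| ≤ c₁ (sup |q_j|)^{2n-2}`,
  taken literally forces `U''(0) = V''(0) = 0`; we do not guess the intended form.
* **Invariance of Gibbs states under the infinite-volume flow** is not printed in LLL 1977 (their
  remark (i), §4, is invariance under the *severed* flows `T_t^α`, by Liouville and energy
  conservation); it is therefore only *defined* here (`PreservesMeasure`), for use as a claim.
* **Uniqueness of the Gibbs state** of the pinned chain is likewise only expressible
  (`Literature.StatMech.HasUniqueGibbsMeasure (chainSpecification P T)`), not asserted.

## Design choices

* Configurations are plain functions `ℤ → ℝ × ℝ` (product σ-algebra from Mathlib), so that the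
  Gibbs framework `Specification ℤ (ℝ × ℝ)` of `GibbsSpecification` applies verbatim with a priori
  measure Lebesgue `volume` on `ℝ × ℝ` and inverse temperature `T⁻¹`.
* Solutions are stated with `HasDerivAt` in each coordinate (LLL (1a)–(1b)); LLL's integral form
  (3) is equivalent for `C¹` forces and not duplicated.
* `InfiniteChainDynamics` carries its own invariant set `carrier` (LLL: `B_r`-data; PR 2026:
  `Ω₂`); outside it `flow` is unconstrained (PR 2026 set `τ_t = id` there). Measurability of
  `flow t` is not a field (no source proves it as stated); `PreservesMeasure` asks for it via
  Mathlib `MeasurePreserving`.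
* Lattice sums / time integrals in the Green–Kubo objects are `tsum` / Bochner integrals (junk `0`
  when divergent); `HasAbsConvergentCorrelation` and integrability are therefore separate
  predicates that a statement must assert.
-/

noncomputable section

open MeasureTheory Filter Topology Set Literature.Probability.LatticeModels
open scoped ContDiff

namespace Literature.MathematicalPhysics.KineticTheory.HeatConduction

/-- Phase space of the infinite chain: configurations `σ = (q_i, p_i)_{i ∈ ℤ}`, `(σ i).1 = q_i`,
`(σ i).2 = p_i` (Lanford–Lebowitz–Lieb 1977, §2, `ν = 1`). [cite: LanfordLebowitzLieb1977, §2] -/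
abbrev ChainConfig : Type := ℤ → ℝ × ℝ

namespace OscillatorChain

variable (P : OscillatorChain)

/-! ### Equations of motion -/

/-- The interaction force on particle `i`: `R_i(q) = -∑_j ∂V_j/∂q_i = V'(q_{i+1} - q_i) - V'(q_i - q_{i-1})`
for the nearest-neighbour chain `V_j(q) = V(q_{j+1} - q_j)` (LLL 1977, eq. (1c)). [cite: LanfordLebowitzLieb1977, §2 eq. (1c)] -/
def interactionForce (σ : ChainConfig) (i : ℤ) : ℝ :=
  deriv P.V ((σ (i + 1)).1 - (σ i).1) - deriv P.V ((σ i).1 - (σ (i - 1)).1)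

/-- The total force `F_i = -U'(q_i) + R_i(q)` (LLL 1977, eq. (1b)). [cite: LanfordLebowitzLieb1977, §2 eq. (1b)] -/
def force (σ : ChainConfig) (i : ℤ) : ℝ :=
  -deriv P.U (σ i).1 + P.interactionForce σ i

/-- LLL's local Lyapunov function `ℒ_i(p_i, q_i) = ½ p_i² + U(q_i) + K` (constant `K` chosen so that
`ℒ ≥ 0`) (LLL 1977, eq. (2b)). [cite: LanfordLebowitzLieb1977, §2 eq. (2b)] -/
def siteEnergy (K : ℝ) (σ : ChainConfig) (i : ℤ) : ℝ :=
  (σ i).2 ^ 2 / 2 + P.U (σ i).1 + K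

/-- `γ : ℝ → ChainConfig` solves the infinite system (1a)–(1b) for all times:
`dq_i/dt = p_i`, `dp_i/dt = F_i(q(t))` for every `i ∈ ℤ`, `t ∈ ℝ`. [cite: LanfordLebowitzLieb1977, §2 eqs. (1a)–(1b)] -/
def IsSolution (γ : ℝ → ChainConfig) : Prop :=
  ∀ (i : ℤ) (t : ℝ), HasDerivAt (fun s => (γ s i).1) (γ t i).2 t ∧
    HasDerivAt (fun s => (γ s i).2) (P.force (γ t) i) t

/-- `γ` solves (1a)–(1b) on the time set `I` (one-sided derivatives at endpoints, e.g.
`I = [0, T]` as in LLL Thm 2). [cite: LanfordLebowitzLieb1977, §2 eqs. (1a)–(1b) and §3] -/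
def IsSolutionOn (γ : ℝ → ChainConfig) (I : Set ℝ) : Prop :=
  ∀ (i : ℤ), ∀ t ∈ I, HasDerivWithinAt (fun s => (γ s i).1) (γ t i).2 I t ∧
    HasDerivWithinAt (fun s => (γ s i).2) (P.force (γ t) i) I t

/-- The **severed dynamics** in the finite region `Λ` (LLL 1977, eqs. (9a)–(9c)): particles in `Λ`
move under the full force `F_i` (computed from the whole configuration), particles outside `Λ`
are "tied down", `dq_i/dt = dp_i/dt = 0`. [cite: LanfordLebowitzLieb1977, §2 eqs. (9a)–(9c)] -/
def IsSeveredSolution (Λ : Finset ℤ) (γ : ℝ → ChainConfig) : Prop :=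
  (∀ i ∈ Λ, ∀ t : ℝ, HasDerivAt (fun s => (γ s i).1) (γ t i).2 t ∧
    HasDerivAt (fun s => (γ s i).2) (P.force (γ t) i) t) ∧
  ∀ i ∉ Λ, ∀ t : ℝ, γ t i = γ 0 i

/-- LLL's class of admissible initial data `ℒ(0) ∈ B_r`: `sup_j e^{-r|j|} ℒ_j < ∞`, i.e.
`½ p_j² + U(q_j) ≤ C e^{r|j|}` for some `C` (the additive constant `K` of `ℒ` is immaterial since
`e^{r|j|} ≥ 1` for `r ≥ 0`) (LLL 1977, Definition before Lemma 1, eq. (4); Thm 1). [cite: LanfordLebowitzLieb1977, §2 eq. (4)] -/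
def expTempered (r : ℝ) : Set ChainConfig :=
  {σ | ∃ C : ℝ, ∀ j : ℤ, P.siteEnergy 0 σ j ≤ C * Real.exp (r * |(j : ℝ)|)}

/-- The microscopic energy current through the bond `(x, x+1)` of the infinite chain,
`j_x = -½ (p_x + p_{x+1}) V'(q_{x+1} - q_x)` (same formula as the finite-chain
`OscillatorChain.bondCurrent`; Bonetto–Lebowitz–Rey-Bellet 2000, §5.2 eq. (23)). [cite: BonettoLebowitzReyBellet2000, §5.2 eq. (23)] -/
def bondCurrentZ (σ : ChainConfig) (x : ℤ) : ℝ :=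
  -(((σ x).2 + (σ (x + 1)).2) / 2 * deriv P.V ((σ (x + 1)).1 - (σ x).1))

/-! ### Gibbs states of the chain (DLR) -/

/-- The interaction potential of the chain in the sense of Georgii: `Φ_{{x}}(σ) = ½ p_x² + U(q_x)`,
`Φ_{{x, x+1}}(σ) = V(q_{x+1} - q_x)`, `Φ_A = 0` otherwise (written choice-free as sums over `A`)
(LLL 1977, §4, Hamiltonian (10) with `U_i = U`, `V_j = V(q_{j+1} - q_j)`; Georgii 2011, Def. 2.7). [cite: LanfordLebowitzLieb1977, §2 eq. (10) and §4] -/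
def chainPotential : Potential ℤ (ℝ × ℝ) := fun A σ =>
  (∑ x ∈ A, if A = {x} then (σ x).2 ^ 2 / 2 + P.U (σ x).1 else 0) +
    ∑ x ∈ A, if A = {x, x + 1} then P.V ((σ (x + 1)).1 - (σ x).1) else 0

/-- The interaction sets meeting the volume `Λ`: the sites `{x}`, `x ∈ Λ`, and the bonds
`{x, x+1}`, `{x-1, x}`, `x ∈ Λ` (LLL 1977, (10): "the sum over all `j` such that
`dist(j, Λ) ≤ D`"). [cite: LanfordLebowitzLieb1977, §2 eq. (10)] -/
def chainSupp (Λ : Finset ℤ) : Finset (Finset ℤ) :=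
  Λ.image (fun x => ({x} : Finset ℤ)) ∪ Λ.image (fun x => ({x, x + 1} : Finset ℤ)) ∪
    Λ.image (fun x => ({x - 1, x} : Finset ℤ))

/-- The finite-volume Gibbs distributions of the chain at temperature `T`:
`γ_Λ(dσ | η) = Z_Λ(η)⁻¹ exp[-H_Λ(q, p)/T] ∏_{j ∈ Λ} dq_j dp_j`, configuration equal to `η` off `Λ`,
`H_Λ = ∑_{i∈Λ} (½p_i² + U(q_i)) + ∑'_j V(q_{j+1} - q_j)` over bonds meeting `Λ` (LLL 1977, §4
eq. (14) with `β = T⁻¹`; built with `gibbsSpecOfPotential`, a priori measure Lebesgue on `ℝ × ℝ`;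
Mathlib's `Measure.tilted` junk `0` if `Z_Λ(η) = ∞`, which is excluded by LLL's condition B2). [cite: LanfordLebowitzLieb1977, §4 eq. (14)] -/
def chainSpecification (T : ℝ) : Specification ℤ (ℝ × ℝ) :=
  gibbsSpecOfPotential (volume : Measure (ℝ × ℝ)) P.chainPotential chainSupp T⁻¹

/-- `μ` is an (infinite-volume, DLR) Gibbs state of the chain `P` at temperature `T`: a probability
measure on `ℤ → ℝ × ℝ` with `μ γ_Λ = μ` for all finite `Λ` (LLL 1977, §4: "Condition B2 makes it
possible to define Gibbs states by an obvious adaptation of the definitions used in other cases";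
Georgii 2011, Def. 1.23). [cite: LanfordLebowitzLieb1977, §4] -/
def IsChainGibbsMeasure (T : ℝ) (μ : Measure ChainConfig) : Prop :=
  IsGibbsMeasure (P.chainSpecification T) μ

/-- LLL's condition **B2**: every finite-volume Gibbs distribution (14) is normalisable, i.e.
`γ_Λ(· | η)` is a probability measure for all finite `Λ` and boundary conditions `η`
(for `Measure.tilted` this says exactly `0 < Z_Λ(η) < ∞`). A PREDICATE on chains (the chain `P`
is an explicit binder, so that the facts census does not read this `Prop`-valued definition as a
closed named fact), not an assertion. [cite: LanfordLebowitzLieb1977, §4 condition B2] -/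
def CondB2 (P : OscillatorChain) (T : ℝ) : Prop :=
  ∀ (Λ : Finset ℤ) (η : ChainConfig), IsProbabilityMeasure (P.chainSpecification T Λ η)

/-- LLL's condition **B1**: for each finite `Λ` the severed equations of motion (9a)–(9c) admit
solutions for all time for all initial points. A PREDICATE on chains (explicit binder `P`, same
reason as for `CondB2`), not an assertion. [cite: LanfordLebowitzLieb1977, §4 condition B1] -/
def CondB1 (P : OscillatorChain) : Prop :=
  ∀ (Λ : Finset ℤ) (σ : ChainConfig), ∃ γ : ℝ → ChainConfig, γ 0 = σ ∧ P.IsSeveredSolution Λ γ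

end OscillatorChain

/-! ### Infinite-volume dynamics as a structure -/

/-- An **infinite-volume dynamics** for the chain `P`: a set `carrier` of admissible (tempered)
configurations and a flow `flow : ℝ → ChainConfig → ChainConfig` preserving `carrier`, such that
for every `σ ∈ carrier` the curve `t ↦ flow t σ` solves (1a)–(1b) with `flow 0 σ = σ`, and which is
the unique solution staying in `carrier` (LLL 1977, Thms 1–2: existence for `ℒ(0) ∈ B_r`,
uniqueness in a growth class; Pozzoli–Raquépas 2026, Prop. 2.19: the dynamical group `τ_t` on
`Ω₂`). Outside `carrier` the map `flow t` is unconstrained. [cite: LanfordLebowitzLieb1977, §2 Thm 1 and §3 Thm 2] -/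
structure InfiniteChainDynamics (P : OscillatorChain) where
  /-- the invariant set of admissible initial data -/
  carrier : Set ChainConfig
  /-- the flow `φ_t` -/
  flow : ℝ → ChainConfig → ChainConfig
  /-- `φ_t` maps the carrier into itself -/
  mapsTo : ∀ t, MapsTo (flow t) carrier carrier
  /-- `φ_0 = id` on the carrier -/
  flow_zero : ∀ σ ∈ carrier, flow 0 σ = σ
  /-- orbits are solutions of the equations of motion -/
  isSolution : ∀ σ ∈ carrier, P.IsSolution fun t => flow t σ
  /-- uniqueness: every solution staying in the carrier is an orbit of the flow -/
  unique : ∀ γ : ℝ → ChainConfig, (∀ t, γ t ∈ carrier) → P.IsSolution γ →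
    ∀ t, γ t = flow t (γ 0)

namespace InfiniteChainDynamics

variable {P : OscillatorChain} (D : InfiniteChainDynamics P)

/-- Orbits stay in the carrier. [folklore] -/
theorem flow_mem {σ : ChainConfig} (hσ : σ ∈ D.carrier) (t : ℝ) : D.flow t σ ∈ D.carrier :=
  D.mapsTo t hσ

/-- Time-shifts of solutions are solutions (autonomous system). [folklore] -/
theorem _root_.Literature.MathematicalPhysics.KineticTheory.HeatConduction.OscillatorChain.IsSolution.comp_add_const
    {γ : ℝ → ChainConfig} (hγ : P.IsSolution γ) (s : ℝ) :
    P.IsSolution fun t => γ (t + s) := by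
  intro i t
  obtain ⟨h1, h2⟩ := hγ i (t + s)
  exact ⟨HasDerivAt.comp_add_const t s h1, HasDerivAt.comp_add_const t s h2⟩

/-- **Group law** `φ_{t+s} = φ_t ∘ φ_s` on the carrier, a consequence of uniqueness
(Pozzoli–Raquépas 2026, Prop. 2.19, "dynamical group"). [folklore] -/
theorem flow_add {σ : ChainConfig} (hσ : σ ∈ D.carrier) (t s : ℝ) :
    D.flow (t + s) σ = D.flow t (D.flow s σ) := by
  have h := D.unique (fun u => D.flow (u + s) σ) (fun u => D.flow_mem hσ _)
    ((D.isSolution σ hσ).comp_add_const s) t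
  simpa using h

/-- `D` **preserves** the measure `μ`: `μ` is carried by the admissible set and every `φ_t` is
measure preserving (Mathlib `MeasurePreserving`, which includes measurability of `φ_t`). Not a
theorem of LLL 1977 for the infinite-volume flow (their §4 remark (i) concerns the severed flows);
defined here for use as a claim. [folklore] -/
def PreservesMeasure (μ : Measure ChainConfig) : Prop :=
  (∀ᵐ σ ∂μ, σ ∈ D.carrier) ∧ ∀ t : ℝ, MeasurePreserving (D.flow t) μ μ

/-- The space-summed current autocorrelation `C(t) = ∑_{x ∈ ℤ} ∫ j_0(σ) j_x(φ_t σ) dμ(σ)`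
(infinite-volume, translation-invariant form of `L⁻¹⟨Φ Ŝ_t Φ⟩`, `Φ = ∑_x j_x`, in the
Green–Kubo formula, BLR 2000 eq. (37); `tsum`/Bochner junk `0` when divergent, see
`HasAbsConvergentCorrelation`). [cite: BonettoLebowitzReyBellet2000, §7 eq. (37)] -/
def currentCorrelation (μ : Measure ChainConfig) (t : ℝ) : ℝ :=
  ∑' x : ℤ, ∫ σ, P.bondCurrentZ σ 0 * P.bondCurrentZ (D.flow t σ) x ∂μ

/-- The sum defining `C(t)` converges absolutely: each `j_0 · (j_x ∘ φ_t)` is `μ`-integrable and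
`∑_x |∫ j_0 (j_x ∘ φ_t) dμ| < ∞`. [folklore] -/
def HasAbsConvergentCorrelation (μ : Measure ChainConfig) (t : ℝ) : Prop :=
  (∀ x : ℤ, Integrable (fun σ => P.bondCurrentZ σ 0 * P.bondCurrentZ (D.flow t σ) x) μ) ∧
    Summable fun x : ℤ => |∫ σ, P.bondCurrentZ σ 0 * P.bondCurrentZ (D.flow t σ) x ∂μ|

/-- The **Green–Kubo conductivity** `κ_GK(T) = T⁻² ∫_0^∞ C(t) dt` of the dynamics `D` in the
state `μ` at temperature `T` (BLR 2000, eq. (37), `lim_L L/(A T²) ∫_0^∞ ⟨Φ Ŝ_t Φ⟩ dt`, in the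
infinite-volume form; Bochner junk `0` if `C ∉ L¹`). [cite: BonettoLebowitzReyBellet2000, §7 eq. (37)] -/
def greenKuboConductivity (μ : Measure ChainConfig) (T : ℝ) : ℝ :=
  (T ^ 2)⁻¹ * ∫ t in Ioi (0 : ℝ), D.currentCorrelation μ t

/-- **Green–Kubo holds** for `(D, μ)` at temperature `T`, junk-free: the correlation sum converges
absolutely at every time, `C ∈ L¹(0, ∞)`, and `0 < κ_GK(T)` (finiteness is automatic for a real
number; positivity and the two convergence clauses are the content) (BLR 2000, §7, eq. (37) and
the discussion following it). [cite: BonettoLebowitzReyBellet2000, §7 eq. (37)] -/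
def HasGreenKubo (μ : Measure ChainConfig) (T : ℝ) : Prop :=
  (∀ t : ℝ, D.HasAbsConvergentCorrelation μ t) ∧
    IntegrableOn (D.currentCorrelation μ) (Ioi 0) ∧ 0 < D.greenKuboConductivity μ T

/-- `HasGreenKubo` gives a positive conductivity. [folklore] -/
theorem HasGreenKubo.pos {D : InfiniteChainDynamics P} {μ : Measure ChainConfig} {T : ℝ}
    (h : D.HasGreenKubo μ T) : 0 < D.greenKuboConductivity μ T :=
  h.2.2

end InfiniteChainDynamics

/-! ### Named facts (Lanford–Lebowitz–Lieb 1977), chain instances -/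

namespace OscillatorChain

variable (P : OscillatorChain)

/-- **LLL 1977, Theorem 1 (strong existence), for the nearest-neighbour chain.** Assume
A2: `U, V ∈ C²`; A3: `|q| ≤ C₁ U(q) + C₂` with `C₁, C₂ ≥ 0`; A4 (range `D = 1`): for some constant
`K` with `ℒ = ½p² + U(q) + K ≥ 0` there is `A ≥ 0` with
`|p_i R_i(q)| ≤ A (ℒ_{i-1} + ℒ_i + ℒ_{i+1})` for all configurations and sites (LLL's
`A_ij < C`, `A_ij = 0` for `|i-j| > 1`). Then for every initial datum with `ℒ(0) ∈ B_r` (`r > 0`)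
there exists a solution of (1a)–(1c) defined for all `t`, with `σ` at time `0`, and satisfying,
for every `T`, `ℒ_j(t) ≤ K' e^{r|j|}` for `|t| ≤ T` (proof of Thm 1, from Lemma 1 (5)). LLL's
Example: A3–A4 hold for `U` a polynomial of degree `2n` with positive leading coefficient and
`R_i` of degree `≤ n` — NOT for quartic `U` with quartic `V`. Statement only. [cite: LanfordLebowitzLieb1977, §2 Thm 1 and Lemma 1] -/
def LanfordLebowitzLieb1977_thm1_chain : Prop :=
  ∀ (P : OscillatorChain), ContDiff ℝ 2 P.U → ContDiff ℝ 2 P.V →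
    (∃ C₁ C₂ : ℝ, 0 ≤ C₁ ∧ 0 ≤ C₂ ∧ ∀ q : ℝ, |q| ≤ C₁ * P.U q + C₂) →
    (∃ K : ℝ, (∀ σ : ChainConfig, ∀ i, 0 ≤ P.siteEnergy K σ i) ∧
      ∃ A : ℝ, 0 ≤ A ∧ ∀ (σ : ChainConfig) (i : ℤ),
        |(σ i).2 * P.interactionForce σ i| ≤
          A * (P.siteEnergy K σ (i - 1) + P.siteEnergy K σ i + P.siteEnergy K σ (i + 1))) →
    ∀ (r : ℝ), 0 < r → ∀ σ ∈ P.expTempered r,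
      ∃ γ : ℝ → ChainConfig, γ 0 = σ ∧ P.IsSolution γ ∧
        ∀ T : ℝ, ∃ K' : ℝ, ∀ t : ℝ, |t| ≤ T → ∀ j : ℤ,
          P.siteEnergy 0 (γ t) j ≤ K' * Real.exp (r * |(j : ℝ)|)

/-- **LLL 1977, Theorem 3 (weak existence for general interactions), for the chain.** Assume A1
(finite range — automatic here), A2: `U, V ∈ C²`, B1: the severed dynamics (9a)–(9c) have global
solutions for all initial points, B2: the finite-volume Gibbs distributions (14) at `β = T⁻¹ > 0`
are normalisable. Let `μ` be a Gibbs state. Then for `μ`-almost every initial point `(q, p)` there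
is a solution of (3) (equivalently (1a)–(1c)) defined for all `t`, starting at `(q, p)`, with
`sup_t sup_i |q_i(t) - q_i| / ((1 + t²) [log₊ i]^{1/2}) < ∞`, `log₊ j = max(log |j|, 1)`
(eq. (15)). No uniqueness is asserted (that is Thm 4, not vendored). Statement only. [cite: LanfordLebowitzLieb1977, §4 Thm 3] -/
def LanfordLebowitzLieb1977_thm3_chain : Prop :=
  ∀ (P : OscillatorChain) (T : ℝ), 0 < T → ContDiff ℝ 2 P.U → ContDiff ℝ 2 P.V →
    P.CondB1 → P.CondB2 T →
    ∀ μ : Measure ChainConfig, P.IsChainGibbsMeasure T μ →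
      ∀ᵐ σ ∂μ, ∃ γ : ℝ → ChainConfig, γ 0 = σ ∧ P.IsSolution γ ∧
        ∃ C : ℝ, ∀ (t : ℝ) (i : ℤ),
          |(γ t i).1 - (σ i).1| ≤ C * (1 + t ^ 2) * Real.sqrt (max (Real.log |(i : ℝ)|) 1)

/-! ### API -/

/-- Unfolding `IsChainGibbsMeasure`. [folklore] -/
theorem isChainGibbsMeasure_iff (T : ℝ) (μ : Measure ChainConfig) :
    P.IsChainGibbsMeasure T μ ↔ IsGibbsMeasure (P.chainSpecification T) μ :=
  Iff.rfl

/-- A Gibbs state of the chain is a probability measure. [folklore] -/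
theorem IsChainGibbsMeasure.isProbabilityMeasure {P : OscillatorChain} {T : ℝ}
    {μ : Measure ChainConfig} (h : P.IsChainGibbsMeasure T μ) : IsProbabilityMeasure μ :=
  h.1

/-- The on-site term of the chain potential: `Φ_{{x}}(σ) = ½ p_x² + U(q_x)`. [folklore] -/
@[simp] theorem chainPotential_singleton (σ : ChainConfig) (x : ℤ) :
    P.chainPotential {x} σ = (σ x).2 ^ 2 / 2 + P.U (σ x).1 := by
  have hne : ({x} : Finset ℤ) ≠ {x, x + 1} := by
    intro h
    have hx : x + 1 ∈ ({x, x + 1} : Finset ℤ) := by simp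
    rw [← h, Finset.mem_singleton] at hx
    omega
  simp [chainPotential, hne]

/-- The bond term of the chain potential: `Φ_{{x, x+1}}(σ) = V(q_{x+1} - q_x)`. [folklore] -/
@[simp] theorem chainPotential_pair (σ : ChainConfig) (x : ℤ) :
    P.chainPotential {x, x + 1} σ = P.V ((σ (x + 1)).1 - (σ x).1) := by
  have hx : x ≠ x + 1 := by omega
  have h1 : ({x, x + 1} : Finset ℤ) ≠ {x} := by
    intro h
    have : x + 1 ∈ ({x} : Finset ℤ) := h ▸ (by simp)
    rw [Finset.mem_singleton] at this; omega
  have h2 : ({x, x + 1} : Finset ℤ) ≠ {x + 1} := by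
    intro h
    have : x ∈ ({x + 1} : Finset ℤ) := h ▸ (by simp)
    rw [Finset.mem_singleton] at this; omega
  have h3 : ({x, x + 1} : Finset ℤ) ≠ {x + 1, x + 1 + 1} := by
    intro h
    have : x ∈ ({x + 1, x + 1 + 1} : Finset ℤ) := h ▸ (by simp)
    simp only [Finset.mem_insert, Finset.mem_singleton] at this; omega
  simp [chainPotential, Finset.sum_pair hx, h1, h2, h3]

/-- The chain potential vanishes on the empty set. [folklore] -/
@[simp] theorem chainPotential_empty (σ : ChainConfig) : P.chainPotential ∅ σ = 0 := by
  simp [chainPotential]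

/-- The site energy with constant `K` is the on-site potential term shifted by `K`. [folklore] -/
theorem siteEnergy_eq (K : ℝ) (σ : ChainConfig) (i : ℤ) :
    P.siteEnergy K σ i = P.chainPotential {i} σ + K := by
  simp [siteEnergy]

/-- The force of the chain in terms of `U'` and `V'`. [folklore] -/
theorem force_eq (σ : ChainConfig) (i : ℤ) :
    P.force σ i = -deriv P.U (σ i).1 + deriv P.V ((σ (i + 1)).1 - (σ i).1) -
      deriv P.V ((σ i).1 - (σ (i - 1)).1) := by
  simp only [force, interactionForce]; ring

/-- The zero configuration is an equilibrium whenever `U'(0) = 0`: the constant curve solves the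
equations of motion. [folklore] -/
theorem isSolution_const_zero (hU : deriv P.U 0 = 0) :
    P.IsSolution fun _ => fun _ => (0, 0) := by
  intro i t
  refine ⟨by simpa using hasDerivAt_const t (0 : ℝ), ?_⟩
  have : P.force (fun _ => (0, 0)) i = 0 := by simp [force, interactionForce, hU]
  rw [this]
  simpa using hasDerivAt_const t (0 : ℝ)

/-- The zero configuration has `ℒ(0) ∈ B_r` for every `r ≥ 0`. [folklore] -/
theorem zero_mem_expTempered {r : ℝ} (hr : 0 ≤ r) :
    (fun _ => ((0 : ℝ), (0 : ℝ))) ∈ P.expTempered r := by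
  refine ⟨max (P.U 0) 0, fun j => ?_⟩
  have h1 : (1 : ℝ) ≤ Real.exp (r * |(j : ℝ)|) := Real.one_le_exp (by positivity)
  calc P.siteEnergy 0 (fun _ => ((0 : ℝ), (0 : ℝ))) j = P.U 0 := by simp [siteEnergy]
    _ ≤ max (P.U 0) 0 * 1 := by simp
    _ ≤ max (P.U 0) 0 * Real.exp (r * |(j : ℝ)|) :=
        mul_le_mul_of_nonneg_left h1 (le_max_right _ _)

end OscillatorChain

end Literature.MathematicalPhysics.KineticTheory.HeatConduction

end
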